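import Mathlib.Analysis.FunctionalSpaces.SobolevInequality
import Mathlib.MeasureTheory.Function.LpSeminorm.CompareExp
import Mathlib.MeasureTheory.Integral.IntervalIntegral.FundThmCalculus
import Mathlib.Analysis.Calculus.Deriv.Mul
import Mathlib.MeasureTheory.Function.LpSpace.ContinuousCompMeasurePreserving
import Literature.Geometry.Riemannian.SobolevChartTransfer
import HarnessLib

/-!
# The Sobolev inequality on a closed Riemannian manifold
# `‖w‖_{L^{p*}} ≤ A ‖∇w‖_{Lᵖ} + B ‖w‖_{Lᵖ}`, `1/p* = 1/p - 1/n`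

For a smooth Riemannian metric `g` on a compact manifold `M` of dimension `n` (modelled on any
finite-dimensional real normed space, boundaryless model; volumes `Vol_g = g.riemVolume`, gradient
norm `|∇w|_g = √(g⁻¹(dw, dw))`), and exponents `1 ≤ p < n`, `1/p' = 1/p - 1/n`, we PROVE

* `exists_sobolev_const` — there are constants `A, B` (depending on `(M, g, p)`) such that for
  every `w ∈ C¹(M)`: `‖w‖_{L^{p'}(Vol_g)} ≤ A ‖ |∇w|_g ‖_{Lᵖ(Vol_g)} + B ‖w‖_{Lᵖ(Vol_g)}`
  (Hebey 1999, Thm. 2.6 / Aubin 1998, Thm. 2.21, qualitative form; the inequality invoked in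
  Topping 2006, proof of Lemma 8.1.8: "the Sobolev inequality (see [15])
  `(∫ φ^{2n/(n-2)})^{(n-2)/2n} ≤ C(g,n)[∫ φ² + ∫ |∇φ|²]^{1/2}`", i.e. the case `p = 2`);
* `sqrt_gradSq_mul_le`, `exists_sqrt_gradSq_le` — `|∇(ρw)|_g ≤ ρ|∇w|_g + |w||∇ρ|_g` and a uniform
  bound for `|∇ρ|_g` of a `C¹` function on a compact manifold;
* `eLpNorm_four_sq_le` — Ladyzhenskaya's inequality `‖v‖₄² ≤ 2C ‖v‖₂ ‖Dv‖₂` for `v ∈ C¹_c` on a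
  `2`-dimensional normed space with an additive Haar measure (GNS with `p = 1` applied to `v²`);
* `exists_ladyzhenskaya_const` — **Ladyzhenskaya's inequality on a closed Riemannian surface**:
  `‖w‖₄² ≤ A ‖w‖₂ ‖ |∇w|_g ‖₂ + B ‖w‖₂²` for `w ∈ C¹(M)`, `dim M = 2` (the multiplicative form,
  of degree one in `∇w`, is the scale-correct substitute for the Sobolev exponent `2n/(n-2)` in
  dimension `2`; Ladyzhenskaya 1959);
* `sq_le_two_mul_sqrt_integral_sq`, `exists_sq_le_sqrt_integral_of_finrank_eq_one`,
  `exists_ofReal_sq_le_of_finrank_eq_one` — the one-variable inequality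
  `G(s)² ≤ 2 ‖G‖₂ ‖G'‖₂` for `G ∈ C¹_c(ℝ)` and its transport to a `1`-dimensional normed space
  with an additive Haar measure;
* `exists_ofReal_sq_le_of_finrank_eq_one'` — **Agmon's inequality on a closed curve**:
  `w(x)² ≤ A ‖w‖₂ ‖ |∇w|_g ‖₂ + B ‖w‖₂²` for `w ∈ C¹(M)`, `dim M = 1`, every `x` (again of
  degree one in `∇w`, the scale-correct form in dimension `1`).

Proof: cover `M` by finitely many bi-Lipschitz chart neighbourhoods `Uᵢ`
(`exists_isOpen_biLipschitz_extChartAt`, `ChartMeasureComparison.lean`), take a smooth partition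
of unity `ρᵢ` subordinate to it (Mathlib), write `w = ∑ ρᵢ w` and use Minkowski
(`eLpNorm_sum_le`); transport each `ρᵢ w` to `E` (`SobolevChartTransfer.lean`:
`eLpNorm_le_and_le_of_biLipschitz`, `contDiff_indicator_comp_symm`,
`norm_fderiv_indicator_comp_symm_le`), apply Mathlib's Gagliardo–Nirenberg–Sobolev inequality
`eLpNorm_le_eLpNorm_fderiv_of_eq` for the additive Haar measure `μHE[n]` of `E` (in dimension
`1`: the fundamental theorem of calculus), transport back, and bound
`|∇(ρᵢ w)| ≤ |∇w| + sup|∇ρᵢ| |w|`. Everything is proved; no definitions, no named facts.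

## References

* E. Hebey, *Nonlinear analysis on manifolds: Sobolev spaces and inequalities*, Courant Lecture
  Notes 5, AMS 1999, Thm. 2.6 (Sobolev embedding `H₁ᵖ ⊂ L^{p*}` on compact manifolds).
* T. Aubin, *Some nonlinear problems in Riemannian geometry*, Springer 1998, Thm. 2.21.
* P. Topping, *Lectures on the Ricci flow*, LMS Lecture Note Series 325, CUP 2006, §8.1, proof of
  Lemma 8.1.8. [Topping2006]
-/

noncomputable section

open Bundle Set Function Filter Manifold MeasureTheory Metric Module
open scoped Manifold ContDiff Topology ENNReal NNReal

namespace Literature.Geometry.Riemannian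

open Lorentzian

section Sobolev

variable {E : Type*} [NormedAddCommGroup E] [NormedSpace ℝ E] [FiniteDimensional ℝ E]
  {H : Type*} [TopologicalSpace H] {I : ModelWithCorners ℝ E H} [I.Boundaryless]
  {M : Type*} [TopologicalSpace M] [T2Space M] [CompactSpace M] [ChartedSpace H M]
  [IsManifold I ∞ M] [MeasurableSpace M] [BorelSpace M]
  (g : PseudoRiemannianMetric I ∞ E (TangentSpace I : M → Type _))

omit [I.Boundaryless] [T2Space M] [CompactSpace M] [MeasurableSpace M] [BorelSpace M] in
/-- **Gradient of a product, pointwise**: `|∇(ρw)|_g ≤ ρ |∇w|_g + |w| |∇ρ|_g` for `ρ ≥ 0`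
(via `|d(ρw)(v)| ≤ ρ|dw(v)| + |w||dρ(v)|` and Cauchy–Schwarz). [folklore] -/
theorem sqrt_gradSq_mul_le (hg : g.IsRiemannian) {ρ w : M → ℝ} {x : M}
    (hρ : MDifferentiableAt I 𝓘(ℝ, ℝ) ρ x) (hw : MDifferentiableAt I 𝓘(ℝ, ℝ) w x) (hρ0 : 0 ≤ ρ x) :
    Real.sqrt (g.gradSq (fun y ↦ ρ y * w y) x) ≤
      ρ x * Real.sqrt (g.gradSq w x) + |w x| * Real.sqrt (g.gradSq ρ x) := by
  set A : ℝ := ρ x * Real.sqrt (g.gradSq w x) + |w x| * Real.sqrt (g.gradSq ρ x) with hA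
  have hA0 : 0 ≤ A := by positivity
  have hb : ∀ v : TangentSpace I x, |mvfderiv I (fun y ↦ ρ y * w y) x v| ≤ A * Real.sqrt (g.val x v v) := by
    intro v
    have h := mvfderiv_mul hρ hw
    rw [show (fun y ↦ ρ y * w y) = (ρ * w) from rfl, h]
    simp only [add_apply, FunLike.coe_smul, Pi.smul_apply, smul_eq_mul]
    calc |ρ x * mvfderiv I w x v + w x * mvfderiv I ρ x v|
        ≤ |ρ x * mvfderiv I w x v| + |w x * mvfderiv I ρ x v| := abs_add_le _ _
      _ = ρ x * |mvfderiv I w x v| + |w x| * |mvfderiv I ρ x v| := by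
          rw [abs_mul, abs_mul, abs_of_nonneg hρ0]
      _ ≤ ρ x * (Real.sqrt (g.gradSq w x) * Real.sqrt (g.val x v v)) +
          |w x| * (Real.sqrt (g.gradSq ρ x) * Real.sqrt (g.val x v v)) := by
          gcongr
          · exact abs_mvfderiv_le_sqrt_gradSq_mul_sqrt g hg w x v
          · exact abs_mvfderiv_le_sqrt_gradSq_mul_sqrt g hg ρ x v
      _ = A * Real.sqrt (g.val x v v) := by rw [hA]; ring
  have h := gradSq_le_sq_of_forall_abs_mvfderiv_le g hg hA0 hb
  calc Real.sqrt (g.gradSq (fun y ↦ ρ y * w y) x) ≤ Real.sqrt (A ^ 2) := Real.sqrt_le_sqrt h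
    _ = A := Real.sqrt_sq hA0


omit [T2Space M] [CompactSpace M] [MeasurableSpace M] [BorelSpace M] in
/-- A uniform bound for `|∇ρ|_g` of a smooth function on a compact manifold. [folklore] -/
theorem exists_sqrt_gradSq_le [CompactSpace M] {ρ : M → ℝ} (hρ : ContMDiff I 𝓘(ℝ, ℝ) 1 ρ) :
    ∃ D : ℝ≥0, ∀ x, Real.sqrt (g.gradSq ρ x) ≤ D := by
  have hc : Continuous (g.gradSq ρ) := continuous_innerDual_mvfderiv g hρ hρ
  obtain ⟨B, hB⟩ := isCompact_univ.exists_bound_of_continuousOn hc.continuousOn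
  refine ⟨⟨Real.sqrt B, Real.sqrt_nonneg _⟩, fun x ↦ Real.sqrt_le_sqrt ?_⟩
  exact (le_abs_self _).trans (by simpa [Real.norm_eq_abs] using hB x (mem_univ x))

/-- **The Sobolev inequality on a closed Riemannian manifold** (Aubin 1998, Thm. 2.21 / Hebey
1999, Thm. 2.6, qualitative form; used in Topping 2006, proof of Lemma 8.1.8, "the Sobolev
inequality (see [15])"). Let `g` be a smooth Riemannian metric on a compact manifold `M` of
dimension `n` (any finite-dimensional normed model space), `1 ≤ p < n`, `1/p' = 1/p - 1/n`. There
are constants `A, B` with, for every `w ∈ C¹(M)`,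
`‖w‖_{L^{p'}(Vol_g)} ≤ A ‖ |∇w|_g ‖_{Lᵖ(Vol_g)} + B ‖w‖_{Lᵖ(Vol_g)}`.
Proof: a finite cover by bi-Lipschitz chart neighbourhoods (`exists_isOpen_biLipschitz_extChartAt`),
a subordinate smooth partition of unity `ρᵢ`, `w = ∑ ρᵢ w`; each `ρᵢ w` is transported to the
model space (`eLpNorm_le_and_le_of_biLipschitz`, `norm_fderiv_indicator_comp_symm_le`), where
Mathlib's Gagliardo–Nirenberg–Sobolev inequality `eLpNorm_le_eLpNorm_fderiv_of_eq` for the Haar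
measure `μHE[n]` applies; finally `|∇(ρᵢ w)| ≤ |∇w| + sup|∇ρᵢ| |w|`.
[cite: Topping2006, §8.1, proof of Lemma 8.1.8] -/
theorem exists_sobolev_const (hg : g.IsRiemannian) {p p' : ℝ≥0} (hp : 1 ≤ p)
    (hpn : (p : ℝ) < finrank ℝ E) (hp' : (p' : ℝ)⁻¹ = (p : ℝ)⁻¹ - (finrank ℝ E : ℝ)⁻¹) :
    ∃ A B : ℝ≥0, ∀ w : M → ℝ, ContMDiff I 𝓘(ℝ, ℝ) 1 w →
      eLpNorm w p' g.riemVolume ≤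
        A * eLpNorm (fun x ↦ Real.sqrt (g.gradSq w x)) p g.riemVolume +
          B * eLpNorm w p g.riemVolume := by
  classical
  letI : MeasurableSpace E := borel E
  haveI : BorelSpace E := ⟨rfl⟩
  set n := finrank ℝ E with hn'
  set μE : Measure E := μHE[n] with hμE
  -- exponents
  have hp0 : 0 < (p : ℝ) := lt_of_lt_of_le one_pos (by exact_mod_cast hp)
  have hn0 : 0 < n := by exact_mod_cast hp0.trans hpn
  have hp'inv : 0 < (p' : ℝ)⁻¹ := by
    rw [hp', sub_pos]
    exact inv_strictAnti₀ hp0 hpn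
  have hp'0 : 0 < p' := by
    have : 0 < (p' : ℝ) := by
      by_contra h
      push Not at h
      have : (p' : ℝ) = 0 := le_antisymm h p'.coe_nonneg
      rw [this, inv_zero] at hp'inv
      exact lt_irrefl _ hp'inv
    exact_mod_cast this
  have hpp' : p ≤ p' := by
    have h1 : (p' : ℝ)⁻¹ ≤ (p : ℝ)⁻¹ := by
      rw [hp', sub_le_self_iff]; positivity
    exact_mod_cast (inv_le_inv₀ (by exact_mod_cast hp'0) hp0).1 h1
  have hp1 : (1 : ℝ≥0∞) ≤ p := by exact_mod_cast hp
  have hp'1 : (1 : ℝ≥0∞) ≤ p' := by exact_mod_cast hp.trans hpp'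
  -- Step 1: a finite cover by bi-Lipschitz chart neighbourhoods and a partition of unity
  choose U hUo hxU hUs C hC0 hup hlow hD using fun x : M ↦ exists_isOpen_biLipschitz_extChartAt g hg x
  obtain ⟨t, ht⟩ := isCompact_univ.elim_finite_subcover U hUo (fun x _ ↦ mem_iUnion.2 ⟨x, hxU x⟩)
  obtain ⟨ρ, hρ⟩ := SmoothPartitionOfUnity.exists_isSubordinate I isClosed_univ
    (fun i : t ↦ U (i : M)) (fun i ↦ hUo i) (by
      intro x _
      obtain ⟨i, hi, hx⟩ := mem_iUnion₂.1 (ht (mem_univ x))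
      exact mem_iUnion.2 ⟨⟨i, hi⟩, hx⟩)
  have hsum : ∀ x, ∑ i, ρ i x = 1 := fun x ↦ by
    rw [← finsum_eq_sum_of_fintype]
    exact ρ.sum_eq_one (mem_univ x)
  have hρs : ∀ i, ContMDiff I 𝓘(ℝ, ℝ) 1 (ρ i) := fun i ↦ (ρ i).contMDiff.of_le (by norm_num)
  choose D hDρ using fun i ↦ exists_sqrt_gradSq_le g (hρs i)
  -- constants
  set K : ℝ≥0 := SNormLESNormFDerivOfEqConst ℝ μE p with hK
  set Acst : t → ℝ≥0 := fun i ↦ C i ^ ((n : ℝ) / p') * K * C i * C i ^ ((n : ℝ) / p) with hAcst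
  refine ⟨∑ i, Acst i, ∑ i, Acst i * D i, fun w hw ↦ ?_⟩
  set vol := g.riemVolume with hvol
  set X := eLpNorm (fun x ↦ Real.sqrt (g.gradSq w x)) p vol with hX
  set Y := eLpNorm w p vol with hY
  -- Step 2: `w = ∑ ρᵢ w`
  set u : t → M → ℝ := fun i x ↦ ρ i x * w x with hu
  have hu1 : ∀ i, ContMDiff I 𝓘(ℝ, ℝ) 1 (u i) := fun i ↦ (hρs i).mul hw
  have hwsum : w = ∑ i, u i := by
    funext x
    simp only [hu, Finset.sum_apply, ← Finset.sum_mul, hsum x, one_mul]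
  have hstep : eLpNorm w p' vol ≤ ∑ i, eLpNorm (u i) p' vol := by
    conv_lhs => rw [hwsum]
    exact eLpNorm_sum_le (fun i _ ↦ (hu1 i).continuous.aestronglyMeasurable) hp'1
  -- Step 3: each piece
  have hpiece : ∀ i, eLpNorm (u i) p' vol ≤ (Acst i : ℝ≥0∞) * X + ((Acst i * D i : ℝ≥0) : ℝ≥0∞) * Y := by
    intro i
    set φ := extChartAt I (i : M) with hφ
    have htsupp : tsupport (u i) ⊆ U i := (tsupport_mul_subset_left).trans (hρ i)
    have hsupp : support (u i) ⊆ U i := (subset_tsupport _).trans htsupp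
    have hKc : IsCompact (tsupport (u i)) := (isClosed_tsupport _).isCompact
    have hsrc : ∀ {q}, q ∈ U i → q ∈ φ.source := fun hq ↦ by
      rw [hφ, extChartAt_source]; exact hUs i hq
    -- the representative `v` and its properties
    set v : E → ℝ := φ.target.indicator (u i ∘ φ.symm) with hv
    obtain ⟨hvd, hvc⟩ := contDiff_indicator_comp_symm (I := I) (i : M) (hu1 i) hKc
      (htsupp.trans (hUs i))
    -- (i) `L^{p'}` transfer to the chart
    have h1 := (eLpNorm_le_and_le_of_biLipschitz g hg (i : M) (hUo i) (hUs i) (hup i) (hlow i)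
      (hu1 i).continuous.measurable hsupp hp'0).1
    -- (ii) Euclidean Gagliardo–Nirenberg–Sobolev
    have h2 : eLpNorm v p' μE ≤ K * eLpNorm (fderiv ℝ v) p μE := by
      rw [hK]
      exact eLpNorm_le_eLpNorm_fderiv_of_eq μE hvd hvc hp hn0 hp'
    -- (iii) the derivative of the representative vs. `|∇(ρᵢ w)|_g`
    set G : M → ℝ := fun x ↦ Real.sqrt (g.gradSq (u i) x) with hG
    have hGc : Continuous G := (continuous_innerDual_mvfderiv g (hu1 i) (hu1 i)).sqrt
    have hGsupp : support G ⊆ U i := by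
      intro x hx
      by_contra hxU
      have hxt : x ∉ tsupport (u i) := fun h ↦ hxU (htsupp h)
      have h0 : g.gradSq (u i) x = 0 := by
        simp [PseudoRiemannianMetric.gradSq, mvfderiv_eq_zero_of_notMem_tsupport hxt,
          PseudoRiemannianMetric.innerDual]
      exact hx (by simp [hG, h0])
    have hKimg : IsCompact (φ '' tsupport (u i)) :=
      hKc.image_of_continuousOn ((continuousOn_extChartAt _).mono (fun q hq ↦ hsrc (htsupp hq)))
    have hpt : ∀ y, ‖fderiv ℝ v y‖ ≤ ((C i : ℝ) • φ.target.indicator (G ∘ φ.symm)) y := by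
      intro y
      simp only [Pi.smul_apply, smul_eq_mul]
      by_cases hy : y ∈ φ '' tsupport (u i)
      · obtain ⟨q, hq, rfl⟩ := hy
        have hqU : q ∈ U i := htsupp hq
        rw [indicator_of_mem (φ.map_source (hsrc hqU)), Function.comp_apply, φ.left_inv (hsrc hqU)]
        exact norm_fderiv_indicator_comp_symm_le g hg (i : M) (hu1 i) (hUs i) (C i).coe_nonneg
          (hD i) hqU
      · have h0 := fderiv_eq_zero_of_eq_zero hKimg (indicator_comp_symm_apply (I := I) (i : M) (u i)).2 hy
        rw [h0, norm_zero]
        exact mul_nonneg (C i).coe_nonneg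
          (indicator_nonneg (fun z _ ↦ Real.sqrt_nonneg _) y)
    have h3 : eLpNorm (fderiv ℝ v) p μE ≤ (C i : ℝ≥0∞) * eLpNorm (φ.target.indicator (G ∘ φ.symm)) p μE := by
      calc eLpNorm (fderiv ℝ v) p μE ≤ eLpNorm ((C i : ℝ) • φ.target.indicator (G ∘ φ.symm)) p μE :=
            eLpNorm_mono_real hpt
        _ = (C i : ℝ≥0∞) * eLpNorm (φ.target.indicator (G ∘ φ.symm)) p μE := by
            rw [eLpNorm_const_smul, Real.enorm_eq_ofReal (C i).coe_nonneg, ENNReal.ofReal_coe_nnreal]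
    -- back to the manifold
    have h4 := (eLpNorm_le_and_le_of_biLipschitz g hg (i : M) (hUo i) (hUs i) (hup i) (hlow i)
      hGc.measurable hGsupp (lt_of_lt_of_le one_pos hp)).2
    -- (iv) `|∇(ρᵢ w)| ≤ |∇w| + Dᵢ |w|`
    have h5 : eLpNorm G p vol ≤ X + (D i : ℝ≥0∞) * Y := by
      have hpt' : ∀ x, ‖G x‖ ≤ ((fun x ↦ Real.sqrt (g.gradSq w x)) + fun x ↦ (D i : ℝ) * ‖w x‖) x := by
        intro x
        rw [Real.norm_of_nonneg (Real.sqrt_nonneg _)]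
        simp only [Pi.add_apply, Real.norm_eq_abs]
        have h := sqrt_gradSq_mul_le g hg ((hρs i x).mdifferentiableAt (by simp))
          ((hw x).mdifferentiableAt (by simp)) (ρ.nonneg i x)
        refine h.trans ?_
        have hρ1 : ρ i x ≤ 1 := ρ.le_one i x
        have ha : ρ i x * Real.sqrt (g.gradSq w x) ≤ Real.sqrt (g.gradSq w x) :=
          mul_le_of_le_one_left (Real.sqrt_nonneg _) hρ1
        have hb : |w x| * Real.sqrt (g.gradSq (ρ i) x) ≤ (D i : ℝ) * |w x| := by
          rw [mul_comm]
          exact mul_le_mul_of_nonneg_right (hDρ i x) (abs_nonneg _)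
        linarith
      calc eLpNorm G p vol
          ≤ eLpNorm ((fun x ↦ Real.sqrt (g.gradSq w x)) + fun x ↦ (D i : ℝ) * ‖w x‖) p vol :=
            eLpNorm_mono_real hpt'
        _ ≤ X + eLpNorm (fun x ↦ (D i : ℝ) * ‖w x‖) p vol :=
            eLpNorm_add_le (continuous_innerDual_mvfderiv g hw hw).sqrt.aestronglyMeasurable
              (continuous_const.mul hw.continuous.norm).aestronglyMeasurable hp1
        _ = X + (D i : ℝ≥0∞) * Y := by
            congr 1
            rw [show (fun x ↦ (D i : ℝ) * ‖w x‖) = (D i : ℝ) • fun x ↦ ‖w x‖ from rfl,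
              eLpNorm_const_smul, eLpNorm_norm, Real.enorm_eq_ofReal (D i).coe_nonneg,
              ENNReal.ofReal_coe_nnreal]
    -- combine
    have hAi : (Acst i : ℝ≥0∞) = (C i : ℝ≥0∞) ^ ((n : ℝ) / p') * K * C i * (C i : ℝ≥0∞) ^ ((n : ℝ) / p) := by
      rw [hAcst]
      push_cast
      rw [ENNReal.coe_rpow_of_nonneg _ (by positivity), ENNReal.coe_rpow_of_nonneg _ (by positivity)]
    calc eLpNorm (u i) p' vol
        ≤ (C i : ℝ≥0∞) ^ ((n : ℝ) / p') * eLpNorm v p' μE := h1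
      _ ≤ (C i : ℝ≥0∞) ^ ((n : ℝ) / p') * (K * ((C i : ℝ≥0∞) *
            ((C i : ℝ≥0∞) ^ ((n : ℝ) / p) * (X + (D i : ℝ≥0∞) * Y)))) := by
          gcongr
          exact h2.trans (by gcongr; exact h3.trans (by gcongr; exact h4.trans (by gcongr)))
      _ = (Acst i : ℝ≥0∞) * X + ((Acst i * D i : ℝ≥0) : ℝ≥0∞) * Y := by
          push_cast
          rw [hAi]
          ring
  -- Step 4: sum up
  calc eLpNorm w p' vol ≤ ∑ i, eLpNorm (u i) p' vol := hstep
    _ ≤ ∑ i, ((Acst i : ℝ≥0∞) * X + ((Acst i * D i : ℝ≥0) : ℝ≥0∞) * Y) :=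
        Finset.sum_le_sum (fun i _ ↦ hpiece i)
    _ = ((∑ i, Acst i : ℝ≥0) : ℝ≥0∞) * X + ((∑ i, Acst i * D i : ℝ≥0) : ℝ≥0∞) * Y := by
        push_cast
        rw [Finset.sum_add_distrib, Finset.sum_mul, Finset.sum_mul]

end Sobolev

/-! ### The Euclidean inequality `‖v‖₄² ≤ 2C ‖v‖₂ ‖∇v‖₂` in dimension `2` -/

/-- **Ladyzhenskaya's inequality on a `2`-dimensional normed space** (Gagliardo–Nirenberg with
`p = 1`, `n = 2`, applied to `v²`): for `v ∈ C¹_c(E)`, `dim E = 2`, `μ` an additive Haar measure,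
`‖v‖_{L⁴}² ≤ 2C ‖v‖_{L²} ‖Dv‖_{L²}` with `C` the Gagliardo–Nirenberg constant of `(E, μ)`
(Ladyzhenskaya 1959; Mathlib's `eLpNorm_le_eLpNorm_fderiv_one`). [folklore] -/
theorem eLpNorm_four_sq_le {E : Type*} [NormedAddCommGroup E] [NormedSpace ℝ E]
    [MeasurableSpace E] [BorelSpace E] [FiniteDimensional ℝ E] (μ : Measure E) [μ.IsAddHaarMeasure]
    (hE : finrank ℝ E = 2) {v : E → ℝ} (hv : ContDiff ℝ 1 v) (hvc : HasCompactSupport v) :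
    eLpNorm v 4 μ ^ (2 : ℝ) ≤
      (2 * eLpNormLESNormFDerivOneConst μ 2 : ℝ≥0∞) * (eLpNorm v 2 μ * eLpNorm (fderiv ℝ v) 2 μ) := by
  set u : E → ℝ := fun x ↦ v x ^ 2 with hu
  have huc : ContDiff ℝ 1 u := hv.pow 2
  have hus : HasCompactSupport u := by
    rw [show u = v * v from funext fun x ↦ by simp [hu, sq]]; exact hvc.mul_right
  have hconj : NNReal.HolderConjugate (finrank ℝ E) 2 := by
    rw [hE]; exact_mod_cast NNReal.HolderConjugate.two_two
  have hGNS := eLpNorm_le_eLpNorm_fderiv_one μ huc hus hconj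
  have hu2 : eLpNorm u 2 μ = eLpNorm v 4 μ ^ (2 : ℝ) := by
    have h := eLpNorm_norm_rpow v (p := 2) (μ := μ) (q := 2) (by norm_num)
    rw [show (2 : ℝ≥0∞) * ENNReal.ofReal 2 = 4 by
      rw [ENNReal.ofReal_ofNat]; norm_num] at h
    rw [← h]
    congr 1
    funext x
    simp [hu, Real.norm_eq_abs, sq_abs]
  have hDu : ∀ x, fderiv ℝ u x = (2 * v x) • fderiv ℝ v x := by
    intro x
    have h := ((hv.differentiable one_ne_zero) x).hasFDerivAt.pow 2
    rw [show u = fun x ↦ v x ^ 2 from rfl, h.fderiv]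
    ext w
    simp [smul_eq_mul]
  have hDu_eq : fderiv ℝ u = (fun x ↦ 2 * v x) • fderiv ℝ v := funext hDu
  have hDvm : AEStronglyMeasurable (fderiv ℝ v) μ :=
    (hv.continuous_fderiv one_ne_zero).aestronglyMeasurable
  have h1 : eLpNorm (fderiv ℝ u) 1 μ ≤ eLpNorm (fun x ↦ 2 * v x) 2 μ * eLpNorm (fderiv ℝ v) 2 μ := by
    rw [hDu_eq]
    exact eLpNorm_smul_le_mul_eLpNorm hDvm (continuous_const.mul hv.continuous).aestronglyMeasurable
  have h2 : eLpNorm (fun x ↦ 2 * v x) 2 μ = 2 * eLpNorm v 2 μ := by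
    rw [show (fun x ↦ 2 * v x) = (2 : ℝ) • v from rfl, eLpNorm_const_smul,
      Real.enorm_eq_ofReal zero_le_two, ENNReal.ofReal_ofNat]
  calc eLpNorm v 4 μ ^ (2 : ℝ) = eLpNorm u 2 μ := hu2.symm
    _ ≤ eLpNormLESNormFDerivOneConst μ 2 * eLpNorm (fderiv ℝ u) 1 μ := hGNS
    _ ≤ eLpNormLESNormFDerivOneConst μ 2 * (2 * eLpNorm v 2 μ * eLpNorm (fderiv ℝ v) 2 μ) := by
        gcongr; rw [← h2]; exact h1
    _ = (2 * eLpNormLESNormFDerivOneConst μ 2 : ℝ≥0∞) * (eLpNorm v 2 μ * eLpNorm (fderiv ℝ v) 2 μ) := by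
        ring

/-! ### Transfer to closed surfaces -/

section Surface

variable {E : Type*} [NormedAddCommGroup E] [NormedSpace ℝ E] [FiniteDimensional ℝ E]
  {H : Type*} [TopologicalSpace H] {I : ModelWithCorners ℝ E H} [I.Boundaryless]
  {M : Type*} [TopologicalSpace M] [T2Space M] [CompactSpace M] [ChartedSpace H M]
  [IsManifold I ∞ M] [MeasurableSpace M] [BorelSpace M]
  (g : PseudoRiemannianMetric I ∞ E (TangentSpace I : M → Type _))

/-- **Ladyzhenskaya's inequality on a closed Riemannian surface**: for a smooth Riemannian metric
on a compact `2`-manifold there are constants `A, B` with, for every `w ∈ C¹(M)`,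
`‖w‖_{L⁴}² ≤ A ‖w‖_{L²} ‖ |∇w|_g ‖_{L²} + B ‖w‖_{L²}²` (partition of unity over bi-Lipschitz chart
neighbourhoods, `eLpNorm_four_sq_le` in each chart; the multiplicative form — degree one in
`∇w` — is what the `2`-dimensional entropy estimate needs). [folklore] -/
theorem exists_ladyzhenskaya_const (hg : g.IsRiemannian) (hE : finrank ℝ E = 2) :
    ∃ A B : ℝ≥0, ∀ w : M → ℝ, ContMDiff I 𝓘(ℝ, ℝ) 1 w →
      eLpNorm w 4 g.riemVolume ^ 2 ≤
        A * (eLpNorm w 2 g.riemVolume * eLpNorm (fun x ↦ Real.sqrt (g.gradSq w x)) 2 g.riemVolume)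
          + B * eLpNorm w 2 g.riemVolume ^ 2 := by
  classical
  letI : MeasurableSpace E := borel E
  haveI : BorelSpace E := ⟨rfl⟩
  set n := finrank ℝ E with hn'
  set μE : Measure E := μHE[n] with hμE
  -- cover and partition of unity
  choose U hUo hxU hUs C hC0 hup hlow hD using fun x : M ↦ exists_isOpen_biLipschitz_extChartAt g hg x
  obtain ⟨t, ht⟩ := isCompact_univ.elim_finite_subcover U hUo (fun x _ ↦ mem_iUnion.2 ⟨x, hxU x⟩)
  obtain ⟨ρ, hρ⟩ := SmoothPartitionOfUnity.exists_isSubordinate I isClosed_univ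
    (fun i : t ↦ U (i : M)) (fun i ↦ hUo i) (by
      intro x _
      obtain ⟨i, hi, hx⟩ := mem_iUnion₂.1 (ht (mem_univ x))
      exact mem_iUnion.2 ⟨⟨i, hi⟩, hx⟩)
  have hsum : ∀ x, ∑ i, ρ i x = 1 := fun x ↦ by
    rw [← finsum_eq_sum_of_fintype]
    exact ρ.sum_eq_one (mem_univ x)
  have hρs : ∀ i, ContMDiff I 𝓘(ℝ, ℝ) 1 (ρ i) := fun i ↦ (ρ i).contMDiff.of_le (by norm_num)
  choose D hDρ using fun i ↦ exists_sqrt_gradSq_le g (hρs i)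
  -- constants: `‖ρᵢw‖₄² ≤ Acst i ‖w‖₂ (‖∇w‖₂ + Dᵢ ‖w‖₂)`
  set K : ℝ≥0 := 2 * eLpNormLESNormFDerivOneConst μE 2 with hK
  set Acst : t → ℝ≥0 := fun i ↦ C i ^ ((n : ℝ) / 4 * 2) * K * C i ^ ((n : ℝ) / 2) *
    (C i * C i ^ ((n : ℝ) / 2)) with hAcst
  set N : ℝ≥0 := (Fintype.card t : ℝ≥0) with hN
  refine ⟨N ^ 2 * ∑ i, Acst i, N ^ 2 * ∑ i, Acst i * D i, fun w hw ↦ ?_⟩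
  set vol := g.riemVolume with hvol
  set Y := eLpNorm w 2 vol with hY
  set Z := eLpNorm (fun x ↦ Real.sqrt (g.gradSq w x)) 2 vol with hZ
  have hp1 : (1 : ℝ≥0∞) ≤ 2 := by norm_num
  have hp4 : (1 : ℝ≥0∞) ≤ 4 := by norm_num
  -- pieces
  set u : t → M → ℝ := fun i x ↦ ρ i x * w x with hu
  have hu1 : ∀ i, ContMDiff I 𝓘(ℝ, ℝ) 1 (u i) := fun i ↦ (hρs i).mul hw
  have hwsum : w = ∑ i, u i := by
    funext x
    simp only [hu, Finset.sum_apply, ← Finset.sum_mul, hsum x, one_mul]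
  -- the common bound `T`
  set T : ℝ≥0∞ := ((∑ i, Acst i : ℝ≥0) : ℝ≥0∞) * (Y * Z) +
    ((∑ i, Acst i * D i : ℝ≥0) : ℝ≥0∞) * Y ^ 2 with hT
  have hpiece : ∀ i, eLpNorm (u i) 4 vol ^ 2 ≤ T := by
    intro i
    set φ := extChartAt I (i : M) with hφ
    have htsupp : tsupport (u i) ⊆ U i := (tsupport_mul_subset_left).trans (hρ i)
    have hsupp : support (u i) ⊆ U i := (subset_tsupport _).trans htsupp
    have hKc : IsCompact (tsupport (u i)) := (isClosed_tsupport _).isCompact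
    have hsrc : ∀ {q}, q ∈ U i → q ∈ φ.source := fun hq ↦ by
      rw [hφ, extChartAt_source]; exact hUs i hq
    set v : E → ℝ := φ.target.indicator (u i ∘ φ.symm) with hv
    obtain ⟨hvd, hvc⟩ := contDiff_indicator_comp_symm (I := I) (i : M) (hu1 i) hKc
      (htsupp.trans (hUs i))
    -- (i) `‖uᵢ‖₄ ≤ C^{n/4} ‖vᵢ‖₄`
    have h1 : eLpNorm (u i) 4 vol ≤ (C i : ℝ≥0∞) ^ ((n : ℝ) / 4) * eLpNorm v 4 μE := by
      have := (eLpNorm_le_and_le_of_biLipschitz g hg (i : M) (hUo i) (hUs i) (hup i) (hlow i)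
        (hu1 i).continuous.measurable hsupp (by norm_num : (0 : ℝ≥0) < 4)).1
      exact_mod_cast this
    -- (ii) Euclidean Ladyzhenskaya
    have h2 := eLpNorm_four_sq_le μE hE hvd hvc
    rw [ENNReal.rpow_two] at h2
    -- (iii) `‖vᵢ‖₂ ≤ C^{n/2} ‖w‖₂`
    have h3 : eLpNorm v 2 μE ≤ (C i : ℝ≥0∞) ^ ((n : ℝ) / 2) * Y := by
      have h : eLpNorm v 2 μE ≤ (C i : ℝ≥0∞) ^ ((n : ℝ) / 2) * eLpNorm (u i) 2 vol := by
        have := (eLpNorm_le_and_le_of_biLipschitz g hg (i : M) (hUo i) (hUs i) (hup i) (hlow i)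
          (hu1 i).continuous.measurable hsupp (by norm_num : (0 : ℝ≥0) < 2)).2
        exact_mod_cast this
      refine h.trans ?_
      gcongr
      refine eLpNorm_mono (fun x ↦ ?_)
      rw [Real.norm_eq_abs, Real.norm_eq_abs, hu]
      simp only [abs_mul, abs_of_nonneg (ρ.nonneg i x)]
      exact mul_le_of_le_one_left (abs_nonneg _) (ρ.le_one i x)
    -- (iv) `‖Dvᵢ‖₂ ≤ C · C^{n/2} (‖∇w‖₂ + Dᵢ‖w‖₂)`
    set G : M → ℝ := fun x ↦ Real.sqrt (g.gradSq (u i) x) with hG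
    have hGc : Continuous G := (continuous_innerDual_mvfderiv g (hu1 i) (hu1 i)).sqrt
    have hGsupp : support G ⊆ U i := by
      intro x hx
      by_contra hxU
      have hxt : x ∉ tsupport (u i) := fun h ↦ hxU (htsupp h)
      have h0 : g.gradSq (u i) x = 0 := by
        simp [PseudoRiemannianMetric.gradSq, mvfderiv_eq_zero_of_notMem_tsupport hxt,
          PseudoRiemannianMetric.innerDual]
      exact hx (by simp [hG, h0])
    have hKimg : IsCompact (φ '' tsupport (u i)) :=
      hKc.image_of_continuousOn ((continuousOn_extChartAt _).mono (fun q hq ↦ hsrc (htsupp hq)))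
    have hpt : ∀ y, ‖fderiv ℝ v y‖ ≤ ((C i : ℝ) • φ.target.indicator (G ∘ φ.symm)) y := by
      intro y
      simp only [Pi.smul_apply, smul_eq_mul]
      by_cases hy : y ∈ φ '' tsupport (u i)
      · obtain ⟨q, hq, rfl⟩ := hy
        have hqU : q ∈ U i := htsupp hq
        rw [indicator_of_mem (φ.map_source (hsrc hqU)), Function.comp_apply, φ.left_inv (hsrc hqU)]
        exact norm_fderiv_indicator_comp_symm_le g hg (i : M) (hu1 i) (hUs i) (C i).coe_nonneg
          (hD i) hqU
      · have h0 := fderiv_eq_zero_of_eq_zero hKimg (indicator_comp_symm_apply (I := I) (i : M) (u i)).2 hy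
        rw [h0, norm_zero]
        exact mul_nonneg (C i).coe_nonneg (indicator_nonneg (fun z _ ↦ Real.sqrt_nonneg _) y)
    have h4a : eLpNorm (fderiv ℝ v) 2 μE ≤ (C i : ℝ≥0∞) * eLpNorm (φ.target.indicator (G ∘ φ.symm)) 2 μE := by
      calc eLpNorm (fderiv ℝ v) 2 μE ≤ eLpNorm ((C i : ℝ) • φ.target.indicator (G ∘ φ.symm)) 2 μE :=
            eLpNorm_mono_real hpt
        _ = (C i : ℝ≥0∞) * eLpNorm (φ.target.indicator (G ∘ φ.symm)) 2 μE := by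
            rw [eLpNorm_const_smul, Real.enorm_eq_ofReal (C i).coe_nonneg, ENNReal.ofReal_coe_nnreal]
    have h4b : eLpNorm (φ.target.indicator (G ∘ φ.symm)) 2 μE ≤ (C i : ℝ≥0∞) ^ ((n : ℝ) / 2) * eLpNorm G 2 vol := by
      have := (eLpNorm_le_and_le_of_biLipschitz g hg (i : M) (hUo i) (hUs i) (hup i) (hlow i)
        hGc.measurable hGsupp (by norm_num : (0 : ℝ≥0) < 2)).2
      exact_mod_cast this
    have h5 : eLpNorm G 2 vol ≤ Z + (D i : ℝ≥0∞) * Y := by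
      have hpt' : ∀ x, ‖G x‖ ≤ ((fun x ↦ Real.sqrt (g.gradSq w x)) + fun x ↦ (D i : ℝ) * ‖w x‖) x := by
        intro x
        rw [Real.norm_of_nonneg (Real.sqrt_nonneg _)]
        simp only [Pi.add_apply, Real.norm_eq_abs]
        have h := sqrt_gradSq_mul_le g hg ((hρs i x).mdifferentiableAt (by simp))
          ((hw x).mdifferentiableAt (by simp)) (ρ.nonneg i x)
        refine h.trans ?_
        have ha : ρ i x * Real.sqrt (g.gradSq w x) ≤ Real.sqrt (g.gradSq w x) :=
          mul_le_of_le_one_left (Real.sqrt_nonneg _) (ρ.le_one i x)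
        have hb : |w x| * Real.sqrt (g.gradSq (ρ i) x) ≤ (D i : ℝ) * |w x| := by
          rw [mul_comm]
          exact mul_le_mul_of_nonneg_right (hDρ i x) (abs_nonneg _)
        linarith
      calc eLpNorm G 2 vol
          ≤ eLpNorm ((fun x ↦ Real.sqrt (g.gradSq w x)) + fun x ↦ (D i : ℝ) * ‖w x‖) 2 vol :=
            eLpNorm_mono_real hpt'
        _ ≤ Z + eLpNorm (fun x ↦ (D i : ℝ) * ‖w x‖) 2 vol :=
            eLpNorm_add_le (continuous_innerDual_mvfderiv g hw hw).sqrt.aestronglyMeasurable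
              (continuous_const.mul hw.continuous.norm).aestronglyMeasurable hp1
        _ = Z + (D i : ℝ≥0∞) * Y := by
            congr 1
            rw [show (fun x ↦ (D i : ℝ) * ‖w x‖) = (D i : ℝ) • fun x ↦ ‖w x‖ from rfl,
              eLpNorm_const_smul, eLpNorm_norm, Real.enorm_eq_ofReal (D i).coe_nonneg,
              ENNReal.ofReal_coe_nnreal]
    -- combine: `‖uᵢ‖₄² ≤ Acst i · (Y Z + Dᵢ Y²)`
    have hAi : (Acst i : ℝ≥0∞) = (C i : ℝ≥0∞) ^ ((n : ℝ) / 4 * 2) * K * (C i : ℝ≥0∞) ^ ((n : ℝ) / 2) *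
        ((C i : ℝ≥0∞) * (C i : ℝ≥0∞) ^ ((n : ℝ) / 2)) := by
      rw [hAcst]
      push_cast
      rw [ENNReal.coe_rpow_of_nonneg _ (by positivity), ENNReal.coe_rpow_of_nonneg _ (by positivity)]
    have hK' : (K : ℝ≥0∞) = (2 * eLpNormLESNormFDerivOneConst μE 2 : ℝ≥0∞) := by
      rw [hK]; push_cast; rfl
    have hstep : eLpNorm (u i) 4 vol ^ 2 ≤
        (Acst i : ℝ≥0∞) * (Y * Z) + ((Acst i * D i : ℝ≥0) : ℝ≥0∞) * Y ^ 2 := by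
      calc eLpNorm (u i) 4 vol ^ 2
          ≤ ((C i : ℝ≥0∞) ^ ((n : ℝ) / 4) * eLpNorm v 4 μE) ^ 2 := by gcongr
        _ = (C i : ℝ≥0∞) ^ ((n : ℝ) / 4 * 2) * eLpNorm v 4 μE ^ 2 := by
            rw [mul_pow, ENNReal.rpow_mul, ENNReal.rpow_two]
        _ ≤ (C i : ℝ≥0∞) ^ ((n : ℝ) / 4 * 2) *
            ((K : ℝ≥0∞) * (((C i : ℝ≥0∞) ^ ((n : ℝ) / 2) * Y) *
              ((C i : ℝ≥0∞) * ((C i : ℝ≥0∞) ^ ((n : ℝ) / 2) * (Z + (D i : ℝ≥0∞) * Y))))) := by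
            gcongr
            rw [hK']
            exact h2.trans (by gcongr; exact h4a.trans (by gcongr; exact h4b.trans (by gcongr)))
        _ = (Acst i : ℝ≥0∞) * (Y * Z) + ((Acst i * D i : ℝ≥0) : ℝ≥0∞) * Y ^ 2 := by
            push_cast
            rw [hAi]
            ring
    refine hstep.trans ?_
    rw [hT]
    gcongr
    · exact_mod_cast Finset.single_le_sum (fun j _ ↦ (zero_le : 0 ≤ Acst j)) (Finset.mem_univ i)
    · exact_mod_cast Finset.single_le_sum (fun j _ ↦ (zero_le : 0 ≤ Acst j * D j)) (Finset.mem_univ i)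
  -- sum: `‖w‖₄ ≤ ∑ ‖uᵢ‖₄ ≤ N √T`, so `‖w‖₄² ≤ N² T`
  have hsqrt : ∀ i, eLpNorm (u i) 4 vol ≤ T ^ (1 / 2 : ℝ) := by
    intro i
    have h := ENNReal.rpow_le_rpow (hpiece i) (by norm_num : (0 : ℝ) ≤ 1 / 2)
    rwa [← ENNReal.rpow_two, ← ENNReal.rpow_mul, show (2 : ℝ) * (1 / 2) = 1 by norm_num,
      ENNReal.rpow_one] at h
  have hstep : eLpNorm w 4 vol ≤ ∑ i, eLpNorm (u i) 4 vol := by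
    conv_lhs => rw [hwsum]
    exact eLpNorm_sum_le (fun i _ ↦ (hu1 i).continuous.aestronglyMeasurable) hp4
  have hwle : eLpNorm w 4 vol ≤ (N : ℝ≥0∞) * T ^ (1 / 2 : ℝ) := by
    refine hstep.trans ((Finset.sum_le_sum (fun i _ ↦ hsqrt i)).trans ?_)
    rw [Finset.sum_const, Finset.card_univ, hN, nsmul_eq_mul]
    push_cast
    rfl
  calc eLpNorm w 4 vol ^ 2 ≤ ((N : ℝ≥0∞) * T ^ (1 / 2 : ℝ)) ^ 2 := by gcongr
    _ = (N : ℝ≥0∞) ^ 2 * T := by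
        rw [mul_pow, ← ENNReal.rpow_two (T ^ (1 / 2 : ℝ)), ← ENNReal.rpow_mul,
          show (1 / 2 : ℝ) * 2 = 1 by norm_num, ENNReal.rpow_one]
    _ = ((N ^ 2 * ∑ i, Acst i : ℝ≥0) : ℝ≥0∞) * (Y * Z) +
        ((N ^ 2 * ∑ i, Acst i * D i : ℝ≥0) : ℝ≥0∞) * Y ^ 2 := by
        rw [hT]
        push_cast
        ring

end Surface

/-! ### Dimension `1`: Agmon's inequality `w(x)² ≤ A ‖w‖₂ ‖∇w‖₂ + B ‖w‖₂²` -/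

section CurveModel

/-- **One variable**: for `G ∈ C¹_c(ℝ)`, `G(s)² ≤ 2 √(∫ G²) √(∫ G'²)` (fundamental theorem of
calculus for `G²` from the left of the support, then Cauchy–Schwarz). [folklore] -/
theorem sq_le_two_mul_sqrt_integral_sq {G : ℝ → ℝ} (hG : ContDiff ℝ 1 G)
    (hGc : HasCompactSupport G) (s : ℝ) :
    G s ^ 2 ≤ 2 * Real.sqrt (∫ t, G t ^ 2) * Real.sqrt (∫ t, deriv G t ^ 2) := by
  have hGd : ∀ t, HasDerivAt G (deriv G t) t := fun t ↦
    ((hG.differentiable one_ne_zero) t).hasDerivAt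
  have hG'c : Continuous (deriv G) := hG.continuous_deriv le_rfl
  have hGcont : Continuous G := hG.continuous
  have hG'cs : HasCompactSupport (deriv G) := hGc.deriv
  -- a point `a < s` to the left of the support, where `G a = 0`
  obtain ⟨b, hb⟩ := hGc.isCompact.bddBelow
  set a : ℝ := min b s - 1 with ha
  have has : a ≤ s := by rw [ha]; linarith [min_le_right b s]
  have hGa : G a = 0 := by
    refine image_eq_zero_of_notMem_tsupport (fun h ↦ ?_)
    have := hb h
    rw [ha] at this
    linarith [min_le_left b s]
  -- FTC for `G²` on `[a, s]`
  have hprod : ∀ t, HasDerivAt (fun t ↦ G t * G t) (deriv G t * G t + G t * deriv G t) t :=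
    fun t ↦ (hGd t).mul (hGd t)
  have hint : IntervalIntegrable (fun t ↦ deriv G t * G t + G t * deriv G t) volume a s :=
    ((hG'c.mul hGcont).add (hGcont.mul hG'c)).intervalIntegrable _ _
  have hFTC := intervalIntegral.integral_eq_sub_of_hasDerivAt (fun t _ ↦ hprod t) hint
  rw [hGa, mul_zero, sub_zero] at hFTC
  -- `G(s)² ≤ ∫_a^s |2 G G'| ≤ ∫ 2 |G| |G'|`
  set P : ℝ → ℝ := fun t ↦ |G t| * |deriv G t| with hP
  have hPc : Continuous P := hGcont.abs.mul hG'c.abs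
  have hPcs : HasCompactSupport P := by
    rw [hP]; exact hGc.abs.mul_right
  have hPi : Integrable P := hPc.integrable_of_hasCompactSupport hPcs
  have hPnn : ∀ t, 0 ≤ P t := fun t ↦ mul_nonneg (abs_nonneg _) (abs_nonneg _)
  have hstep1 : G s ^ 2 ≤ 2 * ∫ t, P t := by
    have h1 : G s ^ 2 = ∫ t in a..s, (deriv G t * G t + G t * deriv G t) := by rw [hFTC]; ring
    have h2 : |∫ t in a..s, (deriv G t * G t + G t * deriv G t)| ≤
        ∫ t in a..s, |deriv G t * G t + G t * deriv G t| :=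
      intervalIntegral.abs_integral_le_integral_abs has
    have h3 : ∫ t in a..s, |deriv G t * G t + G t * deriv G t| = ∫ t in a..s, 2 * P t := by
      refine intervalIntegral.integral_congr (fun t _ ↦ ?_)
      simp only [hP]
      rw [show deriv G t * G t + G t * deriv G t = 2 * (G t * deriv G t) by ring, abs_mul, abs_mul,
        abs_two]
    have h4 : ∫ t in a..s, 2 * P t ≤ ∫ t, 2 * P t := by
      rw [intervalIntegral.integral_of_le has]
      exact setIntegral_le_integral (hPi.const_mul 2) (Eventually.of_forall fun t ↦ by
        simp only [Pi.zero_apply]; linarith [hPnn t])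
    rw [integral_const_mul] at h4
    calc G s ^ 2 ≤ |G s ^ 2| := le_abs_self _
      _ = |∫ t in a..s, (deriv G t * G t + G t * deriv G t)| := by rw [h1]
      _ ≤ 2 * ∫ t, P t := by linarith [h2, h3.le, h3.ge, h4]
  -- Cauchy–Schwarz
  have hCS : ∫ t, P t ≤ Real.sqrt (∫ t, G t ^ 2) * Real.sqrt (∫ t, deriv G t ^ 2) := by
    have h := integral_mul_le_Lp_mul_Lq_of_nonneg (μ := volume) Real.HolderConjugate.two_two
      (Eventually.of_forall fun t ↦ abs_nonneg (G t))
      (Eventually.of_forall fun t ↦ abs_nonneg (deriv G t))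
      (hGcont.abs.memLp_of_hasCompactSupport (μ := volume) hGc.abs)
      (hG'c.abs.memLp_of_hasCompactSupport (μ := volume) hG'cs.abs)
    simp only [hP] at h ⊢
    convert h using 2
    · rw [Real.sqrt_eq_rpow]
      congr 1
      · exact integral_congr_ae (Eventually.of_forall fun t ↦ by simp [sq_abs])
    · rw [Real.sqrt_eq_rpow]
      congr 1
      · exact integral_congr_ae (Eventually.of_forall fun t ↦ by simp [sq_abs])
  calc G s ^ 2 ≤ 2 * ∫ t, P t := hstep1
    _ ≤ 2 * (Real.sqrt (∫ t, G t ^ 2) * Real.sqrt (∫ t, deriv G t ^ 2)) := by gcongr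
    _ = 2 * Real.sqrt (∫ t, G t ^ 2) * Real.sqrt (∫ t, deriv G t ^ 2) := by ring

/-- **The model space of dimension `1`**: `v(x)² ≤ K √(∫ v² dμ) √(∫ ‖Dv‖² dμ)` for
`v ∈ C¹_c(E)`, `dim E = 1`, `μ` an additive Haar measure on `E` (transport of
`sq_le_two_mul_sqrt_integral_sq` along a linear isomorphism `ℝ ≃ E`, uniqueness of Haar measure
up to a scalar). [folklore] -/
theorem exists_sq_le_sqrt_integral_of_finrank_eq_one {E : Type*} [NormedAddCommGroup E]
    [NormedSpace ℝ E] [MeasurableSpace E] [BorelSpace E] [FiniteDimensional ℝ E] (μ : Measure E)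
    [μ.IsAddHaarMeasure] (hE : finrank ℝ E = 1) :
    ∃ K : ℝ, 0 ≤ K ∧ ∀ v : E → ℝ, ContDiff ℝ 1 v → HasCompactSupport v → ∀ x,
      v x ^ 2 ≤ K * Real.sqrt (∫ y, v y ^ 2 ∂μ) * Real.sqrt (∫ y, ‖fderiv ℝ v y‖ ^ 2 ∂μ) := by
  set e : ℝ ≃L[ℝ] E := ContinuousLinearEquiv.ofFinrankEq (by simp [hE]) with he
  set ν : Measure E := Measure.map e volume with hν
  haveI : ν.IsAddHaarMeasure := e.isAddHaarMeasure_map volume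
  set c : ℝ≥0 := Measure.addHaarScalarFactor μ ν with hc
  have hcpos : 0 < c := Measure.addHaarScalarFactor_pos_of_isAddHaarMeasure μ ν
  have hemb : MeasurableEmbedding e := e.toHomeomorph.measurableEmbedding
  -- the change of variables for continuous compactly supported functions
  have key : ∀ F : E → ℝ, Continuous F → HasCompactSupport F →
      ∫ y, F y ∂μ = c * ∫ t, F (e t) := by
    intro F hF hFc
    rw [Measure.integral_isAddLeftInvariant_eq_smul_of_hasCompactSupport μ ν hF hFc,
      integral_smul_nnreal_measure, NNReal.smul_def, smul_eq_mul]
    congr 1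
    exact hemb.integral_map F
  refine ⟨2 * ‖e 1‖ / c, by positivity, fun v hv hvc x ↦ ?_⟩
  set G : ℝ → ℝ := v ∘ e with hG
  have hGs : ContDiff ℝ 1 G := hv.comp e.contDiff
  have hGc : HasCompactSupport G := hvc.comp_homeomorph e.toHomeomorph
  have h1 := sq_le_two_mul_sqrt_integral_sq hGs hGc (e.symm x)
  have hGx : G (e.symm x) = v x := by simp [hG]
  rw [hGx] at h1
  -- `∫ G² = (∫ v² dμ)/c`
  have hv2c : Continuous fun y ↦ v y ^ 2 := hv.continuous.pow 2
  have hv2s : HasCompactSupport fun y ↦ v y ^ 2 := by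
    rw [show (fun y ↦ v y ^ 2) = v * v from funext fun y ↦ by simp [sq]]; exact hvc.mul_right
  have hI1 : ∫ t, G t ^ 2 = (∫ y, v y ^ 2 ∂μ) / c := by
    rw [key _ hv2c hv2s, mul_div_cancel_left₀ _ (by positivity : ((c : ℝ)) ≠ 0)]
    rfl
  -- `∫ (G')² ≤ ‖e 1‖² (∫ ‖Dv‖² dμ)/c`
  have hDvc : Continuous fun y ↦ ‖fderiv ℝ v y‖ ^ 2 := (hv.continuous_fderiv one_ne_zero).norm.pow 2
  have hDvs : HasCompactSupport fun y ↦ ‖fderiv ℝ v y‖ ^ 2 := by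
    have h1 : HasCompactSupport fun y ↦ ‖fderiv ℝ v y‖ := (hvc.fderiv (𝕜 := ℝ)).norm
    rw [show (fun y ↦ ‖fderiv ℝ v y‖ ^ 2) = (fun y ↦ ‖fderiv ℝ v y‖) * fun y ↦ ‖fderiv ℝ v y‖ from
      funext fun y ↦ by simp [sq]]
    exact h1.mul_right
  have hderivG : ∀ t, deriv G t = fderiv ℝ v (e t) (e 1) := by
    intro t
    have h1 : HasDerivAt (fun t : ℝ ↦ e t) (e 1) t := e.toContinuousLinearMap.hasDerivAt
    have h2 : HasFDerivAt v (fderiv ℝ v (e t)) (e t) :=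
      ((hv.differentiable one_ne_zero) _).hasFDerivAt
    exact (h2.comp_hasDerivAt t h1).deriv
  have hI2 : ∫ t, deriv G t ^ 2 ≤ ‖e 1‖ ^ 2 * ((∫ y, ‖fderiv ℝ v y‖ ^ 2 ∂μ) / c) := by
    have h1 : ∫ t, ‖fderiv ℝ v (e t)‖ ^ 2 = (∫ y, ‖fderiv ℝ v y‖ ^ 2 ∂μ) / c := by
      rw [key _ hDvc hDvs, mul_div_cancel_left₀ _ (by positivity : ((c : ℝ)) ≠ 0)]
    rw [← h1, ← integral_const_mul]
    refine integral_mono_of_nonneg (Eventually.of_forall fun t ↦ sq_nonneg _) ?_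
      (Eventually.of_forall fun t ↦ ?_)
    · exact ((hDvc.comp e.continuous).const_mul _).integrable_of_hasCompactSupport
        ((hDvs.comp_homeomorph e.toHomeomorph).mul_left)
    · simp only
      rw [hderivG, ← mul_pow]
      have hb : |fderiv ℝ v (e t) (e 1)| ≤ ‖e 1‖ * ‖fderiv ℝ v (e t)‖ := by
        calc |fderiv ℝ v (e t) (e 1)| = ‖fderiv ℝ v (e t) (e 1)‖ := (Real.norm_eq_abs _).symm
          _ ≤ ‖fderiv ℝ v (e t)‖ * ‖e 1‖ := ContinuousLinearMap.le_opNorm _ _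
          _ = ‖e 1‖ * ‖fderiv ℝ v (e t)‖ := mul_comm _ _
      calc fderiv ℝ v (e t) (e 1) ^ 2 = |fderiv ℝ v (e t) (e 1)| ^ 2 := (sq_abs _).symm
        _ ≤ (‖e 1‖ * ‖fderiv ℝ v (e t)‖) ^ 2 := pow_le_pow_left₀ (abs_nonneg _) hb 2
  -- assemble
  have hcR : (0 : ℝ) < c := by exact_mod_cast hcpos
  set r : ℝ := Real.sqrt c with hr
  have hrpos : 0 < r := Real.sqrt_pos.2 hcR
  have hrr : r * r = c := Real.mul_self_sqrt hcR.le
  set V : ℝ := ∫ y, v y ^ 2 ∂μ with hV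
  set W : ℝ := ∫ y, ‖fderiv ℝ v y‖ ^ 2 ∂μ with hW
  have hV0 : 0 ≤ V := integral_nonneg fun y ↦ sq_nonneg _
  have hW0 : 0 ≤ W := integral_nonneg fun y ↦ sq_nonneg _
  have hA : Real.sqrt (∫ t, G t ^ 2) = Real.sqrt V / r := by
    rw [hI1, Real.sqrt_div hV0]
  have hB : Real.sqrt (∫ t, deriv G t ^ 2) ≤ ‖e 1‖ * Real.sqrt W / r := by
    calc Real.sqrt (∫ t, deriv G t ^ 2) ≤ Real.sqrt (‖e 1‖ ^ 2 * (W / c)) := Real.sqrt_le_sqrt hI2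
      _ = ‖e 1‖ * Real.sqrt W / r := by
          rw [Real.sqrt_mul (sq_nonneg _), Real.sqrt_sq (norm_nonneg _), Real.sqrt_div hW0,
            mul_div_assoc]
  have halg : 2 * (Real.sqrt V / r) * (‖e 1‖ * Real.sqrt W / r) =
      2 * ‖e 1‖ / (r * r) * Real.sqrt V * Real.sqrt W := by
    field_simp
  calc v x ^ 2 ≤ 2 * Real.sqrt (∫ t, G t ^ 2) * Real.sqrt (∫ t, deriv G t ^ 2) := h1
    _ ≤ 2 * (Real.sqrt V / r) * (‖e 1‖ * Real.sqrt W / r) := by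
        rw [hA]
        gcongr
    _ = 2 * ‖e 1‖ / c * Real.sqrt V * Real.sqrt W := by rw [halg, hrr]

/-- The same in terms of `L²` norms: `v(x)² ≤ K ‖v‖_{L²(μ)} ‖Dv‖_{L²(μ)}` (as extended
nonnegative reals) for `v ∈ C¹_c(E)`, `dim E = 1`. [folklore] -/
theorem exists_ofReal_sq_le_of_finrank_eq_one {E : Type*} [NormedAddCommGroup E]
    [NormedSpace ℝ E] [MeasurableSpace E] [BorelSpace E] [FiniteDimensional ℝ E] (μ : Measure E)
    [μ.IsAddHaarMeasure] (hE : finrank ℝ E = 1) :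
    ∃ K : ℝ≥0, ∀ v : E → ℝ, ContDiff ℝ 1 v → HasCompactSupport v → ∀ x,
      ENNReal.ofReal (v x ^ 2) ≤ K * (eLpNorm v 2 μ * eLpNorm (fderiv ℝ v) 2 μ) := by
  obtain ⟨K, hK0, hK⟩ := exists_sq_le_sqrt_integral_of_finrank_eq_one μ hE
  let K' : ℝ≥0 := ⟨K, hK0⟩
  have hK' : (K' : ℝ) = K := rfl
  refine ⟨K', fun v hv hvc x ↦ ?_⟩
  have hvm : MemLp v 2 μ := hv.continuous.memLp_of_hasCompactSupport hvc
  have hDm : MemLp (fderiv ℝ v) 2 μ :=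
    (hv.continuous_fderiv one_ne_zero).memLp_of_hasCompactSupport (hvc.fderiv (𝕜 := ℝ))
  -- `√(∫ F²) = ‖F‖_{L²}.toReal` for the two compactly supported continuous integrands
  have h1 : Real.sqrt (∫ y, v y ^ 2 ∂μ) = (eLpNorm v 2 μ).toReal := by
    rw [hvm.eLpNorm_eq_integral_rpow_norm two_ne_zero ENNReal.ofNat_ne_top, ENNReal.toReal_ofNat,
      ENNReal.toReal_ofReal (Real.rpow_nonneg (integral_nonneg fun _ ↦ by positivity) _),
      Real.sqrt_eq_rpow, one_div]
    congr 1
    exact integral_congr_ae (Eventually.of_forall fun y ↦ by simp [sq_abs])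
  have h2 : Real.sqrt (∫ y, ‖fderiv ℝ v y‖ ^ 2 ∂μ) = (eLpNorm (fderiv ℝ v) 2 μ).toReal := by
    rw [hDm.eLpNorm_eq_integral_rpow_norm two_ne_zero ENNReal.ofNat_ne_top, ENNReal.toReal_ofNat,
      ENNReal.toReal_ofReal (Real.rpow_nonneg (integral_nonneg fun _ ↦ by positivity) _),
      Real.sqrt_eq_rpow, one_div]
    congr 1
    exact integral_congr_ae (Eventually.of_forall fun y ↦ by simp)
  have h3 : v x ^ 2 ≤ ((K' : ℝ≥0∞) * (eLpNorm v 2 μ * eLpNorm (fderiv ℝ v) 2 μ)).toReal := by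
    rw [ENNReal.toReal_mul, ENNReal.toReal_mul, ENNReal.coe_toReal, ← h1, ← h2, hK', ← mul_assoc]
    exact hK v hv hvc x
  exact (ENNReal.ofReal_le_ofReal h3).trans ENNReal.ofReal_toReal_le

end CurveModel

section Curve

variable {E : Type*} [NormedAddCommGroup E] [NormedSpace ℝ E] [FiniteDimensional ℝ E]
  {H : Type*} [TopologicalSpace H] {I : ModelWithCorners ℝ E H} [I.Boundaryless]
  {M : Type*} [TopologicalSpace M] [T2Space M] [CompactSpace M] [ChartedSpace H M]
  [IsManifold I ∞ M] [MeasurableSpace M] [BorelSpace M]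
  (g : PseudoRiemannianMetric I ∞ E (TangentSpace I : M → Type _))

/-- **Agmon's inequality on a closed curve** (dimension `1`): for a smooth Riemannian metric on
a compact `1`-manifold there are constants `A, B` with, for every `w ∈ C¹(M)` and every point
`x`, `w(x)² ≤ A ‖w‖_{L²} ‖ |∇w|_g ‖_{L²} + B ‖w‖_{L²}²` (partition of unity over bi-Lipschitz
chart neighbourhoods, `exists_ofReal_sq_le_of_finrank_eq_one` in each chart; the multiplicative
form — degree one in `∇w` — is what the `1`-dimensional entropy estimate needs). [folklore] -/
theorem exists_ofReal_sq_le_of_finrank_eq_one' (hg : g.IsRiemannian) (hE : finrank ℝ E = 1) :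
    ∃ A B : ℝ≥0, ∀ w : M → ℝ, ContMDiff I 𝓘(ℝ, ℝ) 1 w → ∀ x,
      ENNReal.ofReal (w x ^ 2) ≤
        A * (eLpNorm w 2 g.riemVolume * eLpNorm (fun x ↦ Real.sqrt (g.gradSq w x)) 2 g.riemVolume)
          + B * eLpNorm w 2 g.riemVolume ^ 2 := by
  classical
  letI : MeasurableSpace E := borel E
  haveI : BorelSpace E := ⟨rfl⟩
  set n := finrank ℝ E with hn'
  set μE : Measure E := μHE[n] with hμE
  -- cover and partition of unity
  choose U hUo hxU hUs C hC0 hup hlow hD using fun x : M ↦ exists_isOpen_biLipschitz_extChartAt g hg x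
  obtain ⟨t, ht⟩ := isCompact_univ.elim_finite_subcover U hUo (fun x _ ↦ mem_iUnion.2 ⟨x, hxU x⟩)
  obtain ⟨ρ, hρ⟩ := SmoothPartitionOfUnity.exists_isSubordinate I isClosed_univ
    (fun i : t ↦ U (i : M)) (fun i ↦ hUo i) (by
      intro x _
      obtain ⟨i, hi, hx⟩ := mem_iUnion₂.1 (ht (mem_univ x))
      exact mem_iUnion.2 ⟨⟨i, hi⟩, hx⟩)
  have hsum : ∀ x, ∑ i, ρ i x = 1 := fun x ↦ by
    rw [← finsum_eq_sum_of_fintype]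
    exact ρ.sum_eq_one (mem_univ x)
  have hρs : ∀ i, ContMDiff I 𝓘(ℝ, ℝ) 1 (ρ i) := fun i ↦ (ρ i).contMDiff.of_le (by norm_num)
  choose D hDρ using fun i ↦ exists_sqrt_gradSq_le g (hρs i)
  -- the Euclidean constant and the constants `Acst i`
  obtain ⟨K, hK⟩ := exists_ofReal_sq_le_of_finrank_eq_one μE hE
  set Acst : t → ℝ≥0 := fun i ↦ K * C i ^ ((n : ℝ) / 2) * (C i * C i ^ ((n : ℝ) / 2)) with hAcst
  set N : ℝ≥0 := (Fintype.card t : ℝ≥0) with hN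
  refine ⟨N ^ 2 * ∑ i, Acst i, N ^ 2 * ∑ i, Acst i * D i, fun w hw x ↦ ?_⟩
  set vol := g.riemVolume with hvol
  set Y := eLpNorm w 2 vol with hY
  set Z := eLpNorm (fun x ↦ Real.sqrt (g.gradSq w x)) 2 vol with hZ
  have hp1 : (1 : ℝ≥0∞) ≤ 2 := by norm_num
  -- pieces
  set u : t → M → ℝ := fun i x ↦ ρ i x * w x with hu
  have hu1 : ∀ i, ContMDiff I 𝓘(ℝ, ℝ) 1 (u i) := fun i ↦ (hρs i).mul hw
  have hwsum : ∀ y, w y = ∑ i, u i y := fun y ↦ by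
    simp only [hu, ← Finset.sum_mul, hsum y, one_mul]
  -- the common bound `T`
  set T : ℝ≥0∞ := ((∑ i, Acst i : ℝ≥0) : ℝ≥0∞) * (Y * Z) +
    ((∑ i, Acst i * D i : ℝ≥0) : ℝ≥0∞) * Y ^ 2 with hT
  have hpiece : ∀ i, ENNReal.ofReal (u i x ^ 2) ≤ T := by
    intro i
    set φ := extChartAt I (i : M) with hφ
    have htsupp : tsupport (u i) ⊆ U i := (tsupport_mul_subset_left).trans (hρ i)
    have hsupp : support (u i) ⊆ U i := (subset_tsupport _).trans htsupp
    by_cases hxU : x ∈ U i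
    swap
    · have h0 : u i x = 0 := by
        by_contra h
        exact hxU (hsupp (mem_support.2 h))
      simp [h0]
    have hKc : IsCompact (tsupport (u i)) := (isClosed_tsupport _).isCompact
    have hsrc : ∀ {q}, q ∈ U i → q ∈ φ.source := fun hq ↦ by
      rw [hφ, extChartAt_source]; exact hUs i hq
    set v : E → ℝ := φ.target.indicator (u i ∘ φ.symm) with hv
    obtain ⟨hvd, hvc⟩ := contDiff_indicator_comp_symm (I := I) (i : M) (hu1 i) hKc
      (htsupp.trans (hUs i))
    -- (i) `uᵢ x = vᵢ (φ x)`
    have h1 : u i x = v (φ x) := by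
      rw [hv, (indicator_comp_symm_apply (I := I) (i : M) (u i)).1 _ (φ.map_source (hsrc hxU)),
        φ.left_inv (hsrc hxU)]
    -- (ii) Euclidean Agmon
    have h2 := hK v hvd hvc (φ x)
    -- (iii) `‖vᵢ‖₂ ≤ C^{n/2} ‖w‖₂`
    have h3 : eLpNorm v 2 μE ≤ (C i : ℝ≥0∞) ^ ((n : ℝ) / 2) * Y := by
      have h : eLpNorm v 2 μE ≤ (C i : ℝ≥0∞) ^ ((n : ℝ) / 2) * eLpNorm (u i) 2 vol := by
        have := (eLpNorm_le_and_le_of_biLipschitz g hg (i : M) (hUo i) (hUs i) (hup i) (hlow i)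
          (hu1 i).continuous.measurable hsupp (by norm_num : (0 : ℝ≥0) < 2)).2
        exact_mod_cast this
      refine h.trans ?_
      gcongr
      refine eLpNorm_mono (fun x ↦ ?_)
      rw [Real.norm_eq_abs, Real.norm_eq_abs, hu]
      simp only [abs_mul, abs_of_nonneg (ρ.nonneg i x)]
      exact mul_le_of_le_one_left (abs_nonneg _) (ρ.le_one i x)
    -- (iv) `‖Dvᵢ‖₂ ≤ C · C^{n/2} (‖∇w‖₂ + Dᵢ‖w‖₂)`
    set G : M → ℝ := fun x ↦ Real.sqrt (g.gradSq (u i) x) with hG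
    have hGc : Continuous G := (continuous_innerDual_mvfderiv g (hu1 i) (hu1 i)).sqrt
    have hGsupp : support G ⊆ U i := by
      intro x hx
      by_contra hxU
      have hxt : x ∉ tsupport (u i) := fun h ↦ hxU (htsupp h)
      have h0 : g.gradSq (u i) x = 0 := by
        simp [PseudoRiemannianMetric.gradSq, mvfderiv_eq_zero_of_notMem_tsupport hxt,
          PseudoRiemannianMetric.innerDual]
      exact hx (by simp [hG, h0])
    have hKimg : IsCompact (φ '' tsupport (u i)) :=
      hKc.image_of_continuousOn ((continuousOn_extChartAt _).mono (fun q hq ↦ hsrc (htsupp hq)))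
    have hpt : ∀ y, ‖fderiv ℝ v y‖ ≤ ((C i : ℝ) • φ.target.indicator (G ∘ φ.symm)) y := by
      intro y
      simp only [Pi.smul_apply, smul_eq_mul]
      by_cases hy : y ∈ φ '' tsupport (u i)
      · obtain ⟨q, hq, rfl⟩ := hy
        have hqU : q ∈ U i := htsupp hq
        rw [indicator_of_mem (φ.map_source (hsrc hqU)), Function.comp_apply, φ.left_inv (hsrc hqU)]
        exact norm_fderiv_indicator_comp_symm_le g hg (i : M) (hu1 i) (hUs i) (C i).coe_nonneg
          (hD i) hqU
      · have h0 := fderiv_eq_zero_of_eq_zero hKimg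
          (indicator_comp_symm_apply (I := I) (i : M) (u i)).2 hy
        rw [h0, norm_zero]
        exact mul_nonneg (C i).coe_nonneg (indicator_nonneg (fun z _ ↦ Real.sqrt_nonneg _) y)
    have h4a : eLpNorm (fderiv ℝ v) 2 μE ≤
        (C i : ℝ≥0∞) * eLpNorm (φ.target.indicator (G ∘ φ.symm)) 2 μE := by
      calc eLpNorm (fderiv ℝ v) 2 μE ≤ eLpNorm ((C i : ℝ) • φ.target.indicator (G ∘ φ.symm)) 2 μE :=
            eLpNorm_mono_real hpt
        _ = (C i : ℝ≥0∞) * eLpNorm (φ.target.indicator (G ∘ φ.symm)) 2 μE := by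
            rw [eLpNorm_const_smul, Real.enorm_eq_ofReal (C i).coe_nonneg, ENNReal.ofReal_coe_nnreal]
    have h4b : eLpNorm (φ.target.indicator (G ∘ φ.symm)) 2 μE ≤
        (C i : ℝ≥0∞) ^ ((n : ℝ) / 2) * eLpNorm G 2 vol := by
      have := (eLpNorm_le_and_le_of_biLipschitz g hg (i : M) (hUo i) (hUs i) (hup i) (hlow i)
        hGc.measurable hGsupp (by norm_num : (0 : ℝ≥0) < 2)).2
      exact_mod_cast this
    have h5 : eLpNorm G 2 vol ≤ Z + (D i : ℝ≥0∞) * Y := by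
      have hpt' : ∀ x, ‖G x‖ ≤ ((fun x ↦ Real.sqrt (g.gradSq w x)) + fun x ↦ (D i : ℝ) * ‖w x‖) x := by
        intro x
        rw [Real.norm_of_nonneg (Real.sqrt_nonneg _)]
        simp only [Pi.add_apply, Real.norm_eq_abs]
        have h := sqrt_gradSq_mul_le g hg ((hρs i x).mdifferentiableAt (by simp))
          ((hw x).mdifferentiableAt (by simp)) (ρ.nonneg i x)
        refine h.trans ?_
        have ha : ρ i x * Real.sqrt (g.gradSq w x) ≤ Real.sqrt (g.gradSq w x) :=
          mul_le_of_le_one_left (Real.sqrt_nonneg _) (ρ.le_one i x)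
        have hb : |w x| * Real.sqrt (g.gradSq (ρ i) x) ≤ (D i : ℝ) * |w x| := by
          rw [mul_comm]
          exact mul_le_mul_of_nonneg_right (hDρ i x) (abs_nonneg _)
        linarith
      calc eLpNorm G 2 vol
          ≤ eLpNorm ((fun x ↦ Real.sqrt (g.gradSq w x)) + fun x ↦ (D i : ℝ) * ‖w x‖) 2 vol :=
            eLpNorm_mono_real hpt'
        _ ≤ Z + eLpNorm (fun x ↦ (D i : ℝ) * ‖w x‖) 2 vol :=
            eLpNorm_add_le (continuous_innerDual_mvfderiv g hw hw).sqrt.aestronglyMeasurable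
              (continuous_const.mul hw.continuous.norm).aestronglyMeasurable hp1
        _ = Z + (D i : ℝ≥0∞) * Y := by
            congr 1
            rw [show (fun x ↦ (D i : ℝ) * ‖w x‖) = (D i : ℝ) • fun x ↦ ‖w x‖ from rfl,
              eLpNorm_const_smul, eLpNorm_norm, Real.enorm_eq_ofReal (D i).coe_nonneg,
              ENNReal.ofReal_coe_nnreal]
    have h4 : eLpNorm (fderiv ℝ v) 2 μE ≤
        (C i : ℝ≥0∞) * ((C i : ℝ≥0∞) ^ ((n : ℝ) / 2) * (Z + (D i : ℝ≥0∞) * Y)) :=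
      h4a.trans (mul_le_mul' le_rfl (h4b.trans (mul_le_mul' le_rfl h5)))
    -- combine: `uᵢ(x)² ≤ Acst i · (Y Z + Dᵢ Y²)`
    have hAi : (Acst i : ℝ≥0∞) = (K : ℝ≥0∞) * (C i : ℝ≥0∞) ^ ((n : ℝ) / 2) *
        ((C i : ℝ≥0∞) * (C i : ℝ≥0∞) ^ ((n : ℝ) / 2)) := by
      rw [hAcst]
      push_cast
      rw [ENNReal.coe_rpow_of_nonneg _ (by positivity)]
    have hstep : ENNReal.ofReal (u i x ^ 2) ≤
        (Acst i : ℝ≥0∞) * (Y * Z) + ((Acst i * D i : ℝ≥0) : ℝ≥0∞) * Y ^ 2 := by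
      calc ENNReal.ofReal (u i x ^ 2) = ENNReal.ofReal (v (φ x) ^ 2) := by rw [h1]
        _ ≤ (K : ℝ≥0∞) * (eLpNorm v 2 μE * eLpNorm (fderiv ℝ v) 2 μE) := h2
        _ ≤ (K : ℝ≥0∞) * (((C i : ℝ≥0∞) ^ ((n : ℝ) / 2) * Y) *
              ((C i : ℝ≥0∞) * ((C i : ℝ≥0∞) ^ ((n : ℝ) / 2) * (Z + (D i : ℝ≥0∞) * Y)))) :=
            mul_le_mul' le_rfl (mul_le_mul' h3 h4)
        _ = (Acst i : ℝ≥0∞) * (Y * Z) + ((Acst i * D i : ℝ≥0) : ℝ≥0∞) * Y ^ 2 := by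
            push_cast
            rw [hAi]
            ring
    refine hstep.trans ?_
    rw [hT]
    gcongr
    · exact_mod_cast Finset.single_le_sum (fun j _ ↦ (zero_le : 0 ≤ Acst j)) (Finset.mem_univ i)
    · exact_mod_cast Finset.single_le_sum (fun j _ ↦ (zero_le : 0 ≤ Acst j * D j)) (Finset.mem_univ i)
  -- sum: `|w(x)| ≤ ∑ |uᵢ(x)| ≤ N √T`, so `w(x)² ≤ N² T`
  have hsqrt : ∀ i, ENNReal.ofReal |u i x| ≤ T ^ (1 / 2 : ℝ) := by
    intro i
    have h := ENNReal.rpow_le_rpow (hpiece i) (by norm_num : (0 : ℝ) ≤ 1 / 2)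
    rwa [← sq_abs, ENNReal.ofReal_pow (abs_nonneg _), ← ENNReal.rpow_two, ← ENNReal.rpow_mul,
      show (2 : ℝ) * (1 / 2) = 1 by norm_num, ENNReal.rpow_one] at h
  have hwle : ENNReal.ofReal |w x| ≤ (N : ℝ≥0∞) * T ^ (1 / 2 : ℝ) := by
    calc ENNReal.ofReal |w x| ≤ ENNReal.ofReal (∑ i, |u i x|) := by
          rw [hwsum x]; exact ENNReal.ofReal_le_ofReal (Finset.abs_sum_le_sum_abs _ _)
      _ = ∑ i, ENNReal.ofReal |u i x| := ENNReal.ofReal_sum_of_nonneg (fun i _ ↦ abs_nonneg _)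
      _ ≤ ∑ i, T ^ (1 / 2 : ℝ) := Finset.sum_le_sum (fun i _ ↦ hsqrt i)
      _ = (N : ℝ≥0∞) * T ^ (1 / 2 : ℝ) := by
          rw [Finset.sum_const, Finset.card_univ, hN, nsmul_eq_mul]
          push_cast
          rfl
  calc ENNReal.ofReal (w x ^ 2) = (ENNReal.ofReal |w x|) ^ 2 := by
        rw [← sq_abs, ENNReal.ofReal_pow (abs_nonneg _)]
    _ ≤ ((N : ℝ≥0∞) * T ^ (1 / 2 : ℝ)) ^ 2 := by gcongr
    _ = (N : ℝ≥0∞) ^ 2 * T := by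
        rw [mul_pow, ← ENNReal.rpow_two (T ^ (1 / 2 : ℝ)), ← ENNReal.rpow_mul,
          show (1 / 2 : ℝ) * 2 = 1 by norm_num, ENNReal.rpow_one]
    _ = ((N ^ 2 * ∑ i, Acst i : ℝ≥0) : ℝ≥0∞) * (Y * Z) +
        ((N ^ 2 * ∑ i, Acst i * D i : ℝ≥0) : ℝ≥0∞) * Y ^ 2 := by
        rw [hT]
        push_cast
        ring

end Curve


end Literature.Geometry.Riemannian

end
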